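import Summits.Ventures.QEC.Census.CertChunks2F
import Summits.Ventures.QEC.Census.BB.BB144.BZAut4Data
import HarnessLib

/-!
# `BB144` — `bz_aut` data `bzAut4Data` (certA 27af9174ef991c5e, 4-block orbit cover, qec-search-10), side Z, block 1, matrix 0
# (depth 4): KERNEL enumeration, part q1/1 (re-plan ≤ 700000 codewords per theorem; emit_std_enum2.py)

Fast-shape chunk theorems (`chunk1RF` level-1 ranges, `chunk2RF` level-2 ranges for the heavy first rows; qec-type-08's
`CertCheckBZFast` scan + unrolled `wtGt11U`, qec-search-10's `CertChunks2F` twins), each ONE `decide +kernel` under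
`maxHeartbeats 400000000`; bridged to type-10's words by `chunk1RF_eq`/`chunk2RF_eq`/`bzTestZW_eq`. Tier KERNEL-std.
The matrix verdict is assembled in `BZAut4EnumZb1m0.lean`.
-/

namespace Summit.Ventures.QEC.Census.BB144

set_option maxHeartbeats 400000000 in
/-- Block 1, matrix 0, first rows 0 … 15 (budget 3 after the first row; 694452 codewords): pass (fast scan, kernel). -/
theorem enum4Z_1_0_r0 : chunk1RF (BB144.cert.bzTestZW wtGt11U) (BB144.cert.bzPosZ BB144.bzAut4Data 1 0) 3 0 16 = true := by
  decide +kernel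

set_option maxHeartbeats 400000000 in
/-- Block 1, matrix 0, first rows 16 … 71 (budget 3 after the first row; 396606 codewords): pass (fast scan, kernel). -/
theorem enum4Z_1_0_r16 : chunk1RF (BB144.cert.bzTestZW wtGt11U) (BB144.cert.bzPosZ BB144.bzAut4Data 1 0) 3 16 56 = true := by
  decide +kernel

end Summit.Ventures.QEC.Census.BB144
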